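import Summits.NavierStokesRegularity.NavierStokesRegularity.Theses.FlatSwirlGauge
import Literature.Analysis.FluidPDE.FlatSwirlGauge
import Literature.Analysis.FluidPDE.NSQuasipotential
import Literature.Analysis.FluidPDE.VorticityCalculus
import Literature.Analysis.FluidPDE.RadialCalculus
import Literature.Analysis.FluidPDE.HessianLaplacian
import Literature.Analysis.FluidPDE.BiotSavartCurlPair

/-!
# Calculus of the self-similar momentum `x₂/√(ν(T−t)+‖x‖²)` (tools for `MomentumUniformContinuityFalse`)

Negative-side support for the crux `CriticalSwirlRegularity` (stmt-NavierStokesRegularity-1253, route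
`FlatSwirlGauge`), line `registered` (birth skeleton `Cruxes/CriticalSwirlRegularity/Lines/birth.lean`), by the
line lead (2026-08-17). Theorems only (no definitions). This file is the calculus half of the refutation of the
skeleton's load-bearing stub `stub_momentumUniformContinuity` (see the companion file
`MomentumUniformContinuityFalse.lean` for the statement, the witness and the discussion):

* the one-variable profile `σ ↦ (√(τ+σ))⁻¹` and its first two derivatives;
* the spatial profile `ψ(x) = (√(τ+‖x‖²))⁻¹` on `ℝ³` (`τ > 0`): `C²`, directional derivatives
  `∂ₐψ = −(√S)⁻³⟪x,a⟫` and Laplacian `Δψ = 3(√S)⁻⁵‖x‖² − 3(√S)⁻³` (`S = τ + ‖x‖²`), via the in-tree radial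
  calculus `laplacian_comp_norm_sq`;
* the momentum slice `a(x) = x₂ψ(x)`: `C²`, `∂ᵥa = v₂ψ − x₂(√S)⁻³⟪x,v⟫`, and
  `Δa = x₂Δψ − 2x₂(√S)⁻³` (Leibniz rule `laplacian_mul_eq`);
* the time derivative `∂ₜ(x₂/√(ν(T−t)+‖x‖²)) = (ν/2)x₂(√S)⁻³`;
* the elementary real arithmetic of the drift `b = ((∂ₜα/ν − Δα)/‖∇α‖²)∇α`: closed form and bound of the
  numerator, `‖b‖ r ≤ 8`, and the transport identity `∂ₜα = ν(Δα + ⟪b,∇α⟫)`, packaged abstractly in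
  `pointwise_clause` (the three pointwise clauses of the gauge block on the rest state `u ≡ 0`).
-/

noncomputable section

namespace Summit.NavierStokesRegularity.NavierStokesRegularity.Theorems.CriticalSwirlRegularity.Negative

open MeasureTheory Filter Set Metric Real InnerProductSpace
open scoped RealInnerProductSpace Laplacian
open Literature.Analysis.FluidPDE

/-! ### One-variable profile `σ ↦ (√(τ + σ))⁻¹` -/

/-- `d/dσ (√(τ+σ))⁻¹ = −½ (√(τ+σ))⁻³` for `τ + σ > 0`. [folklore] -/
theorem hasDerivAt_inv_sqrt_add {τ σ : ℝ} (h : 0 < τ + σ) :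
    HasDerivAt (fun σ => (Real.sqrt (τ + σ))⁻¹) (-(1 / 2) * ((Real.sqrt (τ + σ))⁻¹) ^ 3) σ := by
  have h1 : HasDerivAt (fun σ => τ + σ) 1 σ := (hasDerivAt_id σ).const_add τ
  have h2 := (h1.sqrt h.ne').fun_inv (Real.sqrt_pos.2 h).ne'
  have hq : 0 < Real.sqrt (τ + σ) := Real.sqrt_pos.2 h
  have hq2 : Real.sqrt (τ + σ) ^ 2 = τ + σ := Real.sq_sqrt h.le
  refine h2.congr_deriv ?_
  rw [inv_pow]
  have hq3 : Real.sqrt (τ + σ) ^ 3 = (τ + σ) * Real.sqrt (τ + σ) := by rw [pow_succ, hq2]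
  rw [hq3, hq2]
  field_simp

/-- `d/dσ (−½ (√(τ+σ))⁻³) = ¾ (√(τ+σ))⁻⁵` for `τ + σ > 0`. [folklore] -/
theorem hasDerivAt_inv_sqrt_add_cube {τ σ : ℝ} (h : 0 < τ + σ) :
    HasDerivAt (fun σ => -(1 / 2) * ((Real.sqrt (τ + σ))⁻¹) ^ 3)
      ((3 / 4) * ((Real.sqrt (τ + σ))⁻¹) ^ 5) σ := by
  have h1 := ((hasDerivAt_inv_sqrt_add h).pow 3).const_mul (-(1 / 2))
  refine h1.congr_deriv ?_
  norm_num
  ring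

/-! ### The spatial profile `ψ(x) = (√(τ + ‖x‖²))⁻¹` on `ℝ³` (`τ > 0`) -/

/-- `ψ` is smooth (here: `C²`) when `τ > 0`. [folklore] -/
theorem contDiff_inv_sqrt_norm_sq {τ : ℝ} (hτ : 0 < τ) :
    ContDiff ℝ 2 (fun x : EuclideanSpace ℝ (Fin 3) => (Real.sqrt (τ + ‖x‖ ^ 2))⁻¹) := by
  have hpos : ∀ x : EuclideanSpace ℝ (Fin 3), 0 < τ + ‖x‖ ^ 2 := fun x => by positivity
  refine ((contDiff_const.add (contDiff_norm_sq ℝ)).sqrt fun x => (hpos x).ne').inv fun x => ?_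
  exact (Real.sqrt_pos.2 (hpos x)).ne'

/-- `∂ₐψ(x) = −(√(τ+‖x‖²))⁻³ ⟪x, a⟫`. [folklore] -/
theorem fderiv_inv_sqrt_norm_sq_apply {τ : ℝ} (hτ : 0 < τ) (x a : EuclideanSpace ℝ (Fin 3)) :
    fderiv ℝ (fun x : EuclideanSpace ℝ (Fin 3) => (Real.sqrt (τ + ‖x‖ ^ 2))⁻¹) x a =
      -((Real.sqrt (τ + ‖x‖ ^ 2))⁻¹) ^ 3 * ⟪x, a⟫ := by
  have hpos : 0 < τ + ‖x‖ ^ 2 := by positivity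
  rw [fderiv_comp_norm_sq_apply (g := fun σ => (Real.sqrt (τ + σ))⁻¹) (hasDerivAt_inv_sqrt_add hpos) a]
  ring

/-- `Δψ(x) = 3(√(τ+‖x‖²))⁻⁵‖x‖² − 3(√(τ+‖x‖²))⁻³`. [folklore] -/
theorem laplacian_inv_sqrt_norm_sq {τ : ℝ} (hτ : 0 < τ) (x : EuclideanSpace ℝ (Fin 3)) :
    (Δ (fun x : EuclideanSpace ℝ (Fin 3) => (Real.sqrt (τ + ‖x‖ ^ 2))⁻¹)) x =
      3 * ((Real.sqrt (τ + ‖x‖ ^ 2))⁻¹) ^ 5 * ‖x‖ ^ 2 - 3 * ((Real.sqrt (τ + ‖x‖ ^ 2))⁻¹) ^ 3 := by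
  have hU : IsOpen (Ioi (-τ)) := isOpen_Ioi
  have hg : ∀ σ ∈ Ioi (-τ), HasDerivAt (fun σ => (Real.sqrt (τ + σ))⁻¹)
      ((fun σ => -(1 / 2) * ((Real.sqrt (τ + σ))⁻¹) ^ 3) σ) σ := fun σ hσ =>
    hasDerivAt_inv_sqrt_add (by rw [mem_Ioi] at hσ; linarith)
  have hz : ‖x‖ ^ 2 ∈ Ioi (-τ) := by rw [mem_Ioi]; nlinarith [sq_nonneg ‖x‖]
  have hpos : 0 < τ + ‖x‖ ^ 2 := by positivity
  rw [laplacian_comp_norm_sq hU hg hz (hasDerivAt_inv_sqrt_add_cube hpos), finrank_euclideanSpace_fin]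
  push_cast
  ring

/-! ### The momentum slice `a(x) = x₂ ψ(x)` -/

/-- `D(y ↦ y₂)(x) h = h₂`. [folklore] -/
theorem fderiv_coord_two_apply (x h : EuclideanSpace ℝ (Fin 3)) :
    fderiv ℝ (fun y : EuclideanSpace ℝ (Fin 3) => y 2) x h = h 2 := by
  have : (fun y : EuclideanSpace ℝ (Fin 3) => y 2) = ⇑(EuclideanSpace.proj (𝕜 := ℝ) (2 : Fin 3)) := rfl
  rw [this, ContinuousLinearMap.fderiv]
  rfl

/-- `Δ(y ↦ y₂) = 0`. [folklore] -/
theorem laplacian_coord_two (x : EuclideanSpace ℝ (Fin 3)) :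
    (Δ (fun y : EuclideanSpace ℝ (Fin 3) => y 2)) x = 0 := by
  have hc : ContDiff ℝ 2 (fun y : EuclideanSpace ℝ (Fin 3) => y 2) :=
    (EuclideanSpace.proj (𝕜 := ℝ) (2 : Fin 3)).contDiff
  rw [laplacian_eq_sum_fderiv_fderiv (EuclideanSpace.basisFun (Fin 3) ℝ) hc x]
  refine Finset.sum_eq_zero fun j _ => ?_
  have : (fun y : EuclideanSpace ℝ (Fin 3) => fderiv ℝ (fun y : EuclideanSpace ℝ (Fin 3) => y 2) y
      ((EuclideanSpace.basisFun (Fin 3) ℝ) j)) = fun _ => ((EuclideanSpace.basisFun (Fin 3) ℝ) j) 2 := by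
    funext y; exact fderiv_coord_two_apply y _
  rw [this, fderiv_fun_const]
  rfl

/-- The momentum slice is `C²` (`τ > 0`). [folklore] -/
theorem contDiff_momentumSlice {τ : ℝ} (hτ : 0 < τ) :
    ContDiff ℝ 2 (fun x : EuclideanSpace ℝ (Fin 3) => x 2 * (Real.sqrt (τ + ‖x‖ ^ 2))⁻¹) :=
  (EuclideanSpace.proj (𝕜 := ℝ) (2 : Fin 3)).contDiff.mul (contDiff_inv_sqrt_norm_sq hτ)

/-- **Directional derivatives of the momentum slice**:
`∂ᵥ(x₂ψ)(x) = v₂ ψ(x) − x₂ (√(τ+‖x‖²))⁻³ ⟪x, v⟫`. [folklore] -/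
theorem fderiv_momentumSlice_apply {τ : ℝ} (hτ : 0 < τ) (x v : EuclideanSpace ℝ (Fin 3)) :
    fderiv ℝ (fun x : EuclideanSpace ℝ (Fin 3) => x 2 * (Real.sqrt (τ + ‖x‖ ^ 2))⁻¹) x v =
      v 2 * (Real.sqrt (τ + ‖x‖ ^ 2))⁻¹ - x 2 * ((Real.sqrt (τ + ‖x‖ ^ 2))⁻¹) ^ 3 * ⟪x, v⟫ := by
  have h1 : DifferentiableAt ℝ (fun y : EuclideanSpace ℝ (Fin 3) => y 2) x :=
    (EuclideanSpace.proj (𝕜 := ℝ) (2 : Fin 3)).differentiableAt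
  have h2 : DifferentiableAt ℝ (fun x : EuclideanSpace ℝ (Fin 3) => (Real.sqrt (τ + ‖x‖ ^ 2))⁻¹) x :=
    ((contDiff_inv_sqrt_norm_sq hτ).differentiable two_ne_zero) x
  rw [fderiv_fun_mul h1 h2]
  simp only [_root_.add_apply, _root_.FunLike.coe_smul, Pi.smul_apply, smul_eq_mul,
    fderiv_coord_two_apply, fderiv_inv_sqrt_norm_sq_apply hτ]
  ring

/-- **Laplacian of the momentum slice**:
`Δ(x₂ψ)(x) = x₂ (3(√S)⁻⁵‖x‖² − 3(√S)⁻³) − 2 x₂ (√S)⁻³`, `S = τ + ‖x‖²`. [folklore] -/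
theorem laplacian_momentumSlice {τ : ℝ} (hτ : 0 < τ) (x : EuclideanSpace ℝ (Fin 3)) :
    (Δ (fun x : EuclideanSpace ℝ (Fin 3) => x 2 * (Real.sqrt (τ + ‖x‖ ^ 2))⁻¹)) x =
      x 2 * (3 * ((Real.sqrt (τ + ‖x‖ ^ 2))⁻¹) ^ 5 * ‖x‖ ^ 2 - 3 * ((Real.sqrt (τ + ‖x‖ ^ 2))⁻¹) ^ 3) -
        2 * x 2 * ((Real.sqrt (τ + ‖x‖ ^ 2))⁻¹) ^ 3 := by
  have hc : ContDiff ℝ 2 (fun y : EuclideanSpace ℝ (Fin 3) => y 2) :=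
    (EuclideanSpace.proj (𝕜 := ℝ) (2 : Fin 3)).contDiff
  rw [laplacian_mul_eq (EuclideanSpace.basisFun (Fin 3) ℝ) hc (contDiff_inv_sqrt_norm_sq hτ) x,
    laplacian_inv_sqrt_norm_sq hτ, laplacian_coord_two]
  simp only [fderiv_coord_two_apply, fderiv_inv_sqrt_norm_sq_apply hτ, EuclideanSpace.basisFun_apply,
    EuclideanSpace.inner_single_right, PiLp.single_apply, Fin.sum_univ_three]
  simp
  ring

/-! ### Time derivative of the momentum at a fixed point -/

/-- `∂ₜ (x₂/√(ν(T−t)+‖x‖²)) = (ν/2) x₂ (√(ν(T−t)+‖x‖²))⁻³` while `ν(T−t)+‖x‖² > 0`. [folklore] -/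
theorem hasDerivAt_momentum_time {ν T t : ℝ} (x : EuclideanSpace ℝ (Fin 3))
    (h : 0 < ν * (T - t) + ‖x‖ ^ 2) :
    HasDerivAt (fun s => x 2 * (Real.sqrt (ν * (T - s) + ‖x‖ ^ 2))⁻¹)
      (ν / 2 * x 2 * ((Real.sqrt (ν * (T - t) + ‖x‖ ^ 2))⁻¹) ^ 3) t := by
  have h1 : HasDerivAt (fun s => ν * (T - s) + ‖x‖ ^ 2) (ν * -1) t :=
    (((hasDerivAt_id t).const_sub T).const_mul ν).add_const _
  have h2 := ((h1.sqrt h.ne').fun_inv (Real.sqrt_pos.2 h).ne').const_mul (x 2)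
  have hq : 0 < Real.sqrt (ν * (T - t) + ‖x‖ ^ 2) := Real.sqrt_pos.2 h
  have hq2 : Real.sqrt (ν * (T - t) + ‖x‖ ^ 2) ^ 2 = ν * (T - t) + ‖x‖ ^ 2 := Real.sq_sqrt h.le
  refine h2.congr_deriv ?_
  rw [inv_pow]
  have hq3 : Real.sqrt (ν * (T - t) + ‖x‖ ^ 2) ^ 3 =
      (ν * (T - t) + ‖x‖ ^ 2) * Real.sqrt (ν * (T - t) + ‖x‖ ^ 2) := by rw [pow_succ, hq2]
  rw [hq3, hq2]
  field_simp

/-! ### Gradient bookkeeping -/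

/-- `|Df(x) v| ≤ ‖∇f(x)‖ ‖v‖` (Cauchy–Schwarz with the in-tree `inner_gradient_left`:
`⟪∇f(x), v⟫ = Df(x) v`). [folklore] -/
theorem abs_fderiv_le_norm_gradient_mul (f : EuclideanSpace ℝ (Fin 3) → ℝ) (x v : EuclideanSpace ℝ (Fin 3)) :
    |fderiv ℝ f x v| ≤ ‖gradient f x‖ * ‖v‖ := by
  rw [← inner_gradient_left]
  exact abs_real_inner_le_norm _ _

/-! ### Elementary real-arithmetic steps (isolated to keep each command small) -/

/-- The drift numerator `E = ∂ₜα/ν − Δα` in closed form: with `q = (√S)⁻¹`,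
`(ν/2·x₂q³)/ν − (x₂(3q⁵‖x‖² − 3q³) − 2x₂q³) = x₂(11/2·q³ − 3q⁵‖x‖²)`. [folklore] -/
theorem drift_numerator_eq {ν : ℝ} (hν : ν ≠ 0) (x₂ n q : ℝ) :
    ν / 2 * x₂ * q ^ 3 / ν - (x₂ * (3 * q ^ 5 * n ^ 2 - 3 * q ^ 3) - 2 * x₂ * q ^ 3) =
      x₂ * (11 / 2 * q ^ 3 - 3 * q ^ 5 * n ^ 2) := by
  field_simp
  ring

/-- Bound on the drift numerator: `|x₂(11/2·q³ − 3q⁵‖x‖²)| ≤ 11/2·|x₂| q³` when `q > 0` and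
`‖x‖² q² ≤ 1`. [folklore] -/
theorem drift_numerator_abs_le {x₂ n q : ℝ} (hq : 0 < q) (hn : n ^ 2 * q ^ 2 ≤ 1) :
    |x₂ * (11 / 2 * q ^ 3 - 3 * q ^ 5 * n ^ 2)| ≤ 11 / 2 * (|x₂| * q ^ 3) := by
  rw [abs_mul]
  have hq3 : 0 < q ^ 3 := pow_pos hq 3
  have h0 : 0 ≤ q ^ 5 * n ^ 2 := by positivity
  have h1 : q ^ 5 * n ^ 2 ≤ q ^ 3 := by nlinarith
  have h2 : 0 ≤ 11 / 2 * q ^ 3 - 3 * q ^ 5 * n ^ 2 := by nlinarith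
  rw [abs_of_nonneg h2]
  nlinarith [abs_nonneg x₂]

/-- `|x₂ q| ≤ 1` when `|x₂| ≤ ‖x‖`, `‖x‖² q² ≤ 1`. [folklore] -/
theorem abs_momentum_le_one {x₂ n q : ℝ} (hx : |x₂| ≤ n) (hn : n ^ 2 * q ^ 2 ≤ 1) :
    |x₂ * q| ≤ 1 := by
  rw [← sq_le_one_iff_abs_le_one, mul_pow]
  have : x₂ ^ 2 ≤ n ^ 2 := by nlinarith [abs_nonneg x₂, sq_abs x₂]
  nlinarith [sq_nonneg q]

/-- **The drift bound.** If `|E| ≤ 11/2·m` and `m r ≤ ‖g‖` with `r ≥ 0`, then the drift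
`b = (E/‖g‖²) g` has `‖b‖ r ≤ 8` (indeed `≤ 11/2`). [folklore] -/
theorem norm_drift_mul_le {g : EuclideanSpace ℝ (Fin 3)} {E m r : ℝ} (hr : 0 ≤ r)
    (hE : |E| ≤ 11 / 2 * m) (hg : m * r ≤ ‖g‖) : ‖(E / ‖g‖ ^ 2) • g‖ * r ≤ 8 := by
  by_cases hg0 : g = 0
  · rw [hg0, smul_zero, norm_zero, zero_mul]; norm_num
  · have hgpos : 0 < ‖g‖ := norm_pos_iff.2 hg0
    rw [norm_smul, Real.norm_eq_abs, abs_div, abs_of_nonneg (sq_nonneg ‖g‖)]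
    rw [show |E| / ‖g‖ ^ 2 * ‖g‖ * r = |E| * r / ‖g‖ by field_simp]
    rw [div_le_iff₀ hgpos]
    calc |E| * r ≤ 11 / 2 * m * r := mul_le_mul_of_nonneg_right hE hr
      _ = 11 / 2 * (m * r) := by ring
      _ ≤ 11 / 2 * ‖g‖ := by linarith
      _ ≤ 8 * ‖g‖ := by linarith

/-- **The transport algebra.** With `b = ((D/ν − L)/‖g‖²) g`:
`D = ν (L + ⟪b, g⟫)` as soon as `ν ≠ 0` and `D = L = 0` wherever `g = 0`. [folklore] -/
theorem transport_algebra {g : EuclideanSpace ℝ (Fin 3)} {D L ν : ℝ} (hν : ν ≠ 0)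
    (h0 : g = 0 → D = 0 ∧ L = 0) :
    D = ν * (L + ⟪((D / ν - L) / ‖g‖ ^ 2) • g, g⟫) := by
  rw [real_inner_smul_left, real_inner_self_eq_norm_sq]
  by_cases hg0 : g = 0
  · obtain ⟨hD, hL⟩ := h0 hg0
    rw [hD, hL, hg0, norm_zero]
    ring
  · have hgn : ‖g‖ ^ 2 ≠ 0 := pow_ne_zero 2 (norm_ne_zero_iff.2 hg0)
    rw [div_mul_cancel₀ _ hgn]
    field_simp
    ring

/-- **The momentum is `C²` below the final time**: `(t,x) ↦ x₂/√(ν(T−t)+‖x‖²)` is `C²` on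
`(T−ρ², T) × B_ρ(0)` (`ν > 0`). [folklore] -/
theorem contDiffOn_momentum {ν T ρ : ℝ} (hν : 0 < ν) :
    ContDiffOn ℝ 2
      (Function.uncurry fun (t : ℝ) (x : EuclideanSpace ℝ (Fin 3)) =>
        x 2 * (Real.sqrt (ν * (T - t) + ‖x‖ ^ 2))⁻¹)
      (Set.Ioo (T - ρ ^ 2) T ×ˢ Metric.ball (0 : EuclideanSpace ℝ (Fin 3)) ρ) := by
  have hpos : ∀ p ∈ Set.Ioo (T - ρ ^ 2) T ×ˢ Metric.ball (0 : EuclideanSpace ℝ (Fin 3)) ρ,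
      0 < ν * (T - p.1) + ‖p.2‖ ^ 2 := fun p hp => by
    rw [Set.mem_prod, Set.mem_Ioo] at hp
    have : 0 < ν * (T - p.1) := mul_pos hν (by linarith [hp.1.2])
    positivity
  have hf : ContDiff ℝ 2 (fun p : ℝ × EuclideanSpace ℝ (Fin 3) => ν * (T - p.1) + ‖p.2‖ ^ 2) :=
    (contDiff_const.mul (contDiff_const.sub contDiff_fst)).add ((contDiff_norm_sq ℝ).comp contDiff_snd)
  have hc : ContDiff ℝ 2 (fun p : ℝ × EuclideanSpace ℝ (Fin 3) => p.2 2) :=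
    (EuclideanSpace.proj (𝕜 := ℝ) (2 : Fin 3)).contDiff.comp contDiff_snd
  exact hc.contDiffOn.mul ((hf.contDiffOn.sqrt fun p hp => (hpos p hp).ne').inv
    fun p hp => (Real.sqrt_pos.2 (hpos p hp)).ne')

/-- Convection by the zero field vanishes: `(0·∇)F = 0`. [folklore] -/
theorem convect_zero_field (F : EuclideanSpace ℝ (Fin 3) → ℝ) (x : EuclideanSpace ℝ (Fin 3)) :
    convect (0 : EuclideanSpace ℝ (Fin 3) → EuclideanSpace ℝ (Fin 3)) F x = 0 := by
  simp [convect]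

/-- **The pointwise gauge clauses on the rest state, abstractly.** For a slice `F` with `|F x| ≤ 1`,
Laplacian value `L`, time-derivative value `D`, and a lower bound `m r² ≤ ‖∇F(x)‖ r` on the gradient with
`|D/ν − L| ≤ 11/2·m` (and `D = L = 0` forced where `∇F(x) = 0`, `r > 0`), the drift
`b = ((D/ν − L)/‖∇F(x)‖²) ∇F(x)` satisfies the three pointwise clauses of the gauge block with `u ≡ 0`,
`C₀ = 8`, `M = 1`, `d = r = cylRadius`. [folklore] -/
theorem pointwise_clause {F : EuclideanSpace ℝ (Fin 3) → ℝ} {x : EuclideanSpace ℝ (Fin 3)} {D L ν m : ℝ}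
    (hν : ν ≠ 0) (hF : |F x| ≤ 1) (hL : (Δ F) x = L) (hE : |D / ν - L| ≤ 11 / 2 * m)
    (hg : m * cylRadius x ^ 2 ≤ ‖gradient F x‖ * cylRadius x)
    (h0 : gradient F x = 0 → 0 < cylRadius x → D = 0 ∧ L = 0) :
    |F x| ≤ 1 ∧
      ⟪curl (0 : EuclideanSpace ℝ (Fin 3) → EuclideanSpace ℝ (Fin 3)) x, gradient F x⟫ = 0 ∧
      (0 < cylRadius x →
        ‖curl (0 : EuclideanSpace ℝ (Fin 3) → EuclideanSpace ℝ (Fin 3)) x‖ * cylRadius x ≤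
            8 * ‖gradient F x‖ ∧
          ‖((D / ν - (Δ F) x) / ‖gradient F x‖ ^ 2) • gradient F x‖ * cylRadius x ≤ 8 ∧
          D + convect (0 : EuclideanSpace ℝ (Fin 3) → EuclideanSpace ℝ (Fin 3)) F x =
            ν * ((Δ F) x + ⟪((D / ν - (Δ F) x) / ‖gradient F x‖ ^ 2) • gradient F x, gradient F x⟫)) := by
  rw [convect_zero_field, add_zero, hL, curl_zero, inner_zero_left, norm_zero, zero_mul]
  generalize gradient F x = g at hg h0 ⊢
  refine ⟨hF, rfl, fun hr => ⟨by positivity, ?_, ?_⟩⟩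
  · have hgl : m * cylRadius x ≤ ‖g‖ := by
      rw [pow_two, ← mul_assoc] at hg
      exact le_of_mul_le_mul_right hg hr
    exact norm_drift_mul_le hr.le hE hgl
  · exact transport_algebra hν fun hg0 => h0 hg0 hr

end Summit.NavierStokesRegularity.NavierStokesRegularity.Theorems.CriticalSwirlRegularity.Negative
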